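import Mathlib
import Literature.Analysis.FluidPDE.SuitableWeak
import Literature.Analysis.FluidPDE.KNSSLiouville
import Literature.Analysis.FluidPDE.LerayHopfProofs
import Summits.NavierStokesRegularity.NavierStokesRegularity.Theses.EulerZoomLiouville
import Summits.NavierStokesRegularity.NavierStokesRegularity.Theorems.TypeILiouvilleTypeIliouvilleNoTypeIIPowerGaugeSteady
import Summits.NavierStokesRegularity.NavierStokesRegularity.Theorems.EulerZoomLiouvillePowerGaugeEulerLiouvilleTimePeriodicTools
import HarnessLib

/-!
# The TIME-PERIODIC stratum of the crux `EulerZoomLiouville.PowerGaugeEulerLiouville`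
# (route №10 `EulerZoomLiouville`, item stmt-NavierStokesRegularity-19832) — every `ρ > 0`

Helper file (theorems only; `--supports stmt-NavierStokesRegularity-19832`, line `birth`, a stratum of
STUB 3 `stub_noCollapseFromZero`). Seat ns-typeII-p3 (cell ns-regularity-ideate §B, D-0081).

THE STRATUM. Let `(u, p)` be an ancient local-energy Euler flow on `(−∞,0) × ℝ³` in Seregin's
power-gauged class with exponent `ρ > 0` (suitable weak, `ν = 0`, `f = 0`, weak spatial gradient `H`,
`a^{2ρ} A(a) + a^{ρ} E(a) + a^{2ρ} D(a) ≤ c` at the origin for every `a > 0`; tree `cknA`/`cknE`/`cknD`),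
and suppose `u` is TIME-PERIODIC: `u(τ − P, ·) = u(τ, ·)` for all `τ < 0`, some period `P > 0`.
Then `u = 0` a.e. on the slab — `powerGaugeEulerLiouville_timePeriodic`.  This STRICTLY CONTAINS rung B
(the steady stratum, `Theorems/EulerZoomLiouvillePowerGaugeEulerLiouvilleSteady.lean`: a steady field is
periodic of every period, and the weak gradient `H` is arbitrary here as there), so the OPEN core of
stub 3 (`0 < ρ ≤ 1/2`) is the genuinely TRANSIENT stratum.  Like rungs A/B this is a FLOOR label in the
sense of critic-2's K-READ 01 §K5: only the ARITHMETIC of the `E`- and `A`-weights is used — no Euler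
system, no pressure, no local energy inequality.

THE PROOF. The period-box bookkeeping of the prequel `…TimePeriodicTools.lean` gives, for the periods
`(N+1)P` and radii `N+1`, `∫_{(−(N+1)P, 0) × B_{N+1}} |H|²_F = 0`; these boxes exhaust the slab, so
`H = 0` a.e. (`weakGradient_ae_zero_of_periodic`).  Then a.e. slice of `u` is a.e. constant
(ns-typeII-p3 g0's `PowerGaugeSteady.ae_slice_const_of_weakGradient_ae_zero`), the `A`-gauge kills the
constant of every slice `τ < 0` (`slice_const_eq_zero_of_gaugeA`: `‖b‖² |B₁| a^{2ρ+2} ≤ c` for all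
`a > √(−τ)`), and slices ⇒ slab is `ae_eq_zero_slab_of_ae_slice`.
`timePeriodic_of_powerGaugeEulerLiouville` records that the stratum is a literal sub-case of the
route decl (so it is strictly inside `E`, never summit-strength).

WHAT THIS IS NOT: not NS, not the crux (OPEN on `0 < ρ ≤ 1/2`: the Chae–Shvydkoy window), and not
the DSS rung C2 (discretely self-similar members are periodic only modulo the class scaling). [folklore]
-/

noncomputable section

-- the summit and its single problem share the name `NavierStokesRegularity` (D-0017 nested layout)
set_option linter.dupNamespace false

open Set Function Filter Topology MeasureTheory Metric TopologicalSpace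
open scoped NNReal ENNReal InnerProductSpace RealInnerProductSpace

namespace Summit.NavierStokesRegularity.NavierStokesRegularity.Theorems.PowerGaugeEulerLiouville.TimePeriodic

open Literature.Analysis Literature.Analysis.FluidPDE
open Summit.NavierStokesRegularity.NavierStokesRegularity.Theorems.TypeIliouvilleNoTypeII

/-! ## (5) The weak gradient of a time-periodic member vanishes a.e. -/

/-- Iterating the period: `u(τ − (N+1)P, ·) = u(τ, ·)` for all `τ < 0` (`P ≥ 0`). [folklore] -/
theorem periodic_nat_mul {X : Type*} {u : ℝ → X} {P : ℝ} (hP : 0 ≤ P)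
    (hu : ∀ τ : ℝ, τ < 0 → u (τ - P) = u τ) (N : ℕ) :
    ∀ τ : ℝ, τ < 0 → u (τ - ((N : ℝ) + 1) * P) = u τ := by
  induction N with
  | zero => intro τ hτ; simpa using hu τ hτ
  | succ N ih =>
    intro τ hτ
    have h1 : τ - ((N : ℝ) + 1) * P < 0 := by
      have : 0 ≤ ((N : ℝ) + 1) * P := by positivity
      linarith
    have h2 := hu _ h1
    rw [ih τ hτ] at h2
    rw [← h2]
    congr 1
    push_cast
    ring

/-- **The weak gradient of a time-periodic class member is zero a.e. on the slab** (`ρ > 0`):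
apply `setLIntegral_periodBox_eq_zero` with the periods `(N+1)P` and radii `N+1`; the boxes
`(−(N+1)P, 0) × B_{N+1}` exhaust the slab. [folklore] -/
theorem weakGradient_ae_zero_of_periodic
    {u : ℝ → EuclideanSpace ℝ (Fin 3) → EuclideanSpace ℝ (Fin 3)}
    {H : ℝ → EuclideanSpace ℝ (Fin 3) → EuclideanSpace ℝ (Fin 3) →L[ℝ] EuclideanSpace ℝ (Fin 3)}
    (hH : HasWeakSpatialGradientOn (slab (EuclideanSpace ℝ (Fin 3)) (Iio 0) isOpen_Iio) u H)
    {P : ℝ} (hP : 0 < P) (hu : ∀ τ : ℝ, τ < 0 → u (τ - P) = u τ)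
    {ρ : ℝ} (hρ : 0 < ρ) {c : ℝ≥0}
    (hE : ∀ a : ℝ, 0 < a →
      ENNReal.ofReal (a ^ ρ) * cknE a (0 : ℝ × EuclideanSpace ℝ (Fin 3)) H ≤ (c : ℝ≥0∞)) :
    ∀ᵐ z ∂(volume.restrict (Iio (0 : ℝ) ×ˢ (univ : Set (EuclideanSpace ℝ (Fin 3))))),
      H z.1 z.2 = 0 := by
  set f : ℝ × EuclideanSpace ℝ (Fin 3) → ℝ≥0∞ :=
    fun z => ENNReal.ofReal (frobeniusNormSq (H z.1 z.2)) with hf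
  have hfm : AEMeasurable f (volume.restrict (Iio (0 : ℝ) ×ˢ (univ : Set (EuclideanSpace ℝ (Fin 3))))) := by
    have h1 : AEStronglyMeasurable (uncurry H)
        (volume.restrict (Iio (0 : ℝ) ×ˢ (univ : Set (EuclideanSpace ℝ (Fin 3))))) := by
      have := hH.locallyIntegrableOn_grad.aestronglyMeasurable
      simpa [slab] using this
    exact ((ENNReal.continuous_ofReal.comp LerayHopfProofs.continuous_frobeniusNormSq).comp_aestronglyMeasurable
      h1).aemeasurable
  -- on each box `(−(N+1)P, 0) × B_{N+1}` the mass vanishes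
  have hbox : ∀ N : ℕ, ∀ᵐ z ∂(volume.restrict
      (Ioo (-(((N : ℝ) + 1) * P)) 0 ×ˢ ball (0 : EuclideanSpace ℝ (Fin 3)) ((N : ℝ) + 1))), f z = 0 := by
    intro N
    have hP' : 0 < ((N : ℝ) + 1) * P := by positivity
    have hper := weakGradient_ae_shift_of_periodic hH hP'.le (periodic_nat_mul hP.le hu N)
    have h0 := setLIntegral_periodBox_eq_zero hP' hper hρ hE ((N : ℝ) + 1)
    have hsub : Ioo (-(((N : ℝ) + 1) * P)) 0 ×ˢ ball (0 : EuclideanSpace ℝ (Fin 3)) ((N : ℝ) + 1) ⊆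
        Iio (0 : ℝ) ×ˢ (univ : Set (EuclideanSpace ℝ (Fin 3))) :=
      prod_mono (fun τ hτ => hτ.2) (subset_univ _)
    exact (lintegral_eq_zero_iff' (hfm.mono_set hsub)).1 h0
  -- the boxes exhaust the slab
  have hU : (Iio (0 : ℝ) ×ˢ (univ : Set (EuclideanSpace ℝ (Fin 3)))) =
      ⋃ N : ℕ, (Ioo (-(((N : ℝ) + 1) * P)) 0 ×ˢ ball (0 : EuclideanSpace ℝ (Fin 3)) ((N : ℝ) + 1)) := by
    ext z
    simp only [mem_prod, mem_Iio, mem_univ, and_true, mem_iUnion, mem_Ioo, mem_ball_zero_iff]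
    constructor
    · intro hz
      obtain ⟨N, hN⟩ := exists_nat_gt (max (-z.1 / P) ‖z.2‖)
      refine ⟨N, ⟨?_, hz⟩, ?_⟩
      · have h1 : -z.1 / P < (N : ℝ) + 1 := by linarith [le_max_left (-z.1 / P) ‖z.2‖]
        rw [div_lt_iff₀ hP] at h1
        linarith
      · linarith [le_max_right (-z.1 / P) ‖z.2‖]
    · rintro ⟨N, ⟨-, h2⟩, -⟩
      exact h2
  rw [hU, ae_restrict_iUnion_iff]
  intro N
  filter_upwards [hbox N] with z hz
  have h1 : frobeniusNormSq (H z.1 z.2) ≤ 0 := ENNReal.ofReal_eq_zero.1 hz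
  have h2 : ‖H z.1 z.2‖ ^ 2 ≤ 0 := (sq_opNorm_le_frobeniusNormSq _).trans h1
  exact norm_eq_zero.1 (by nlinarith [norm_nonneg (H z.1 z.2)])

/-! ## (6) The `A`-gauge kills the constant of every slice -/

/-- **A slice constant with bounded `a^{2ρ} A(a)` vanishes**: if `u τ = b` a.e. for some `τ < 0` and
`a^{2ρ} A(u; Q_a(0)) ≤ c` for all `a > 0` (`ρ > 0`), then `b = 0` — for `a > √(−τ)` the slice `τ`
enters the supremum, `A(a) ≥ a⁻¹ ‖b‖² |B_a| = ‖b‖² |B₁| a²`, and `‖b‖² |B₁| a^{2ρ+2} ≤ c` fails for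
large `a`. [folklore] -/
theorem slice_const_eq_zero_of_gaugeA {ρ : ℝ} (hρ : 0 < ρ)
    {u : ℝ → EuclideanSpace ℝ (Fin 3) → EuclideanSpace ℝ (Fin 3)} {τ : ℝ} (hτ : τ < 0)
    {b : EuclideanSpace ℝ (Fin 3)} (hb : u τ =ᵐ[volume] fun _ => b) {c : ℝ≥0}
    (hA : ∀ a : ℝ, 0 < a → ENNReal.ofReal (a ^ (2 * ρ)) *
      cknA a (0 : ℝ × EuclideanSpace ℝ (Fin 3)) u ≤ (c : ℝ≥0∞)) :
    b = 0 := by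
  by_contra hne
  set κ : ℝ≥0∞ := ‖b‖ₑ ^ 2 * volume (ball (0 : EuclideanSpace ℝ (Fin 3)) 1) with hκ
  have hκ0 : κ ≠ 0 :=
    mul_ne_zero (pow_ne_zero _ (by simpa using hne)) (measure_ball_pos volume _ one_pos).ne'
  -- for every `a > √(−τ)`: `κ · a^{2ρ+2} ≤ c`
  have key : ∀ a : ℝ, Real.sqrt (-τ) < a → κ * ENNReal.ofReal (a ^ (2 * ρ + 2)) ≤ (c : ℝ≥0∞) := by
    intro a ha'
    have ha : 0 < a := lt_of_le_of_lt (Real.sqrt_nonneg _) ha'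
    have hτa : -(a ^ 2) < τ := by
      have h1 : Real.sqrt (-τ) ^ 2 = -τ := Real.sq_sqrt (by linarith)
      nlinarith [Real.sqrt_nonneg (-τ)]
    have h1 := hA a ha
    have hslice : (ENNReal.ofReal a)⁻¹ * ∫⁻ x in ball (0 : EuclideanSpace ℝ (Fin 3)) a, ‖u τ x‖ₑ ^ 2 ≤
        cknA a (0 : ℝ × EuclideanSpace ℝ (Fin 3)) u := by
      unfold cknA
      have hs : τ ∈ Ioo ((0 : ℝ × EuclideanSpace ℝ (Fin 3)).1 - a ^ 2)
          (0 : ℝ × EuclideanSpace ℝ (Fin 3)).1 := by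
        simp only [Prod.fst_zero, zero_sub, mem_Ioo]
        exact ⟨hτa, hτ⟩
      exact le_iSup₂ (f := fun t (_ : t ∈ Ioo ((0 : ℝ × EuclideanSpace ℝ (Fin 3)).1 - a ^ 2)
          (0 : ℝ × EuclideanSpace ℝ (Fin 3)).1) =>
          (ENNReal.ofReal a)⁻¹ * ∫⁻ x in ball (0 : ℝ × EuclideanSpace ℝ (Fin 3)).2 a, ‖u t x‖ₑ ^ 2) τ hs
    have hint : ∫⁻ x in ball (0 : EuclideanSpace ℝ (Fin 3)) a, ‖u τ x‖ₑ ^ 2 =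
        ‖b‖ₑ ^ 2 * (ENNReal.ofReal (a ^ 3) * volume (ball (0 : EuclideanSpace ℝ (Fin 3)) 1)) := by
      have h2 : ∫⁻ x in ball (0 : EuclideanSpace ℝ (Fin 3)) a, ‖u τ x‖ₑ ^ 2 =
          ∫⁻ x in ball (0 : EuclideanSpace ℝ (Fin 3)) a, ‖b‖ₑ ^ 2 := by
        refine lintegral_congr_ae (ae_restrict_of_ae ?_)
        filter_upwards [hb] with x hx
        rw [hx]
      rw [h2, lintegral_const, Measure.restrict_apply_univ, Measure.addHaar_ball_of_pos _ _ ha,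
        finrank_euclideanSpace_fin]
    have h3 : ENNReal.ofReal (a ^ (2 * ρ)) * ((ENNReal.ofReal a)⁻¹ *
        (‖b‖ₑ ^ 2 * (ENNReal.ofReal (a ^ 3) * volume (ball (0 : EuclideanSpace ℝ (Fin 3)) 1)))) ≤
        (c : ℝ≥0∞) := by
      rw [← hint]
      exact le_trans (by gcongr) h1
    have h5 : ENNReal.ofReal (a ^ (2 * ρ)) * (ENNReal.ofReal a)⁻¹ * ENNReal.ofReal (a ^ 3) =
        ENNReal.ofReal (a ^ (2 * ρ + 2)) := by
      rw [← ENNReal.ofReal_inv_of_pos ha, ← ENNReal.ofReal_mul (by positivity),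
        ← ENNReal.ofReal_mul (by positivity)]
      congr 1
      rw [show (2 * ρ + 2 : ℝ) = 2 * ρ + ((2 : ℕ) : ℝ) by norm_num, Real.rpow_add ha,
        Real.rpow_natCast]
      field_simp
    have h4 : ENNReal.ofReal (a ^ (2 * ρ)) * ((ENNReal.ofReal a)⁻¹ *
        (‖b‖ₑ ^ 2 * (ENNReal.ofReal (a ^ 3) * volume (ball (0 : EuclideanSpace ℝ (Fin 3)) 1)))) =
        κ * ENNReal.ofReal (a ^ (2 * ρ + 2)) := by
      rw [hκ, ← h5]; ring
    rw [h4] at h3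
    exact h3
  -- let `a → ∞`
  have hlim : Tendsto (fun a : ℝ => κ * ENNReal.ofReal (a ^ (2 * ρ + 2))) atTop (𝓝 ⊤) := by
    have h' := ENNReal.Tendsto.const_mul (a := κ)
      (ENNReal.tendsto_ofReal_atTop.comp (tendsto_rpow_atTop (by linarith : 0 < 2 * ρ + 2)))
      (Or.inl ENNReal.top_ne_zero)
    rwa [ENNReal.mul_top hκ0] at h'
  obtain ⟨a, hca, ha⟩ :=
    ((hlim.eventually_const_lt (ENNReal.coe_lt_top (r := c))).and
      (eventually_gt_atTop (Real.sqrt (-τ)))).exists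
  exact lt_irrefl _ (hca.trans_le (key a ha))

/-! ## (7) The stratum -/

/-- **The TIME-PERIODIC stratum of `EulerZoomLiouville.PowerGaugeEulerLiouville`, every `ρ > 0`.**
An ancient local-energy Euler flow `(u, p)` on `(−∞, 0) × ℝ³` (suitable weak, `ν = 0`, `f = 0`, weak
spatial gradient `H`) in Seregin's power-gauged class `a^{2ρ} A(a) + a^{ρ} E(a) + a^{2ρ} D(a) ≤ c`
(all `a > 0`) which is TIME-PERIODIC — `u(τ − P, ·) = u(τ, ·)` for all `τ < 0`, some `P > 0` —
vanishes a.e. on the slab.  Proof: the `E`-gauge and periodicity force `H = 0` a.e.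
(`weakGradient_ae_zero_of_periodic`), so a.e. slice is a.e. constant
(`PowerGaugeSteady.ae_slice_const_of_weakGradient_ae_zero`), and the `A`-gauge kills every slice
constant (`slice_const_eq_zero_of_gaugeA`).  Contains the steady rung B; the Euler system and the
local energy inequality (`_hsw`) are not used. [folklore] -/
theorem powerGaugeEulerLiouville_timePeriodic :
    ∀ ρ : ℝ, 0 < ρ → ∀ (u : ℝ → EuclideanSpace ℝ (Fin 3) → EuclideanSpace ℝ (Fin 3))
      (p : ℝ → EuclideanSpace ℝ (Fin 3) → ℝ)
      (H : ℝ → EuclideanSpace ℝ (Fin 3) → EuclideanSpace ℝ (Fin 3) →L[ℝ] EuclideanSpace ℝ (Fin 3))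
      (c : NNReal) (P : ℝ), 0 < P → (∀ τ : ℝ, τ < 0 → u (τ - P) = u τ) →
      Literature.Analysis.FluidPDE.IsSuitableWeakSolutionOn
          (Literature.Analysis.FluidPDE.slab (EuclideanSpace ℝ (Fin 3)) (Set.Iio 0) isOpen_Iio) 0 0 u p →
      Literature.Analysis.FluidPDE.HasWeakSpatialGradientOn
          (Literature.Analysis.FluidPDE.slab (EuclideanSpace ℝ (Fin 3)) (Set.Iio 0) isOpen_Iio) u H →
      (∀ a : ℝ, 0 < a →
        ENNReal.ofReal (a ^ (2 * ρ)) *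
            Literature.Analysis.FluidPDE.cknA a (0 : ℝ × EuclideanSpace ℝ (Fin 3)) u +
          ENNReal.ofReal (a ^ ρ) *
            Literature.Analysis.FluidPDE.cknE a (0 : ℝ × EuclideanSpace ℝ (Fin 3)) H +
          ENNReal.ofReal (a ^ (2 * ρ)) *
            Literature.Analysis.FluidPDE.cknD a (0 : ℝ × EuclideanSpace ℝ (Fin 3)) p ≤
          (c : ENNReal)) →
      Function.uncurry u =ᵐ[volume.restrict
        (Set.Iio (0 : ℝ) ×ˢ (Set.univ : Set (EuclideanSpace ℝ (Fin 3))))] 0 := by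
  intro ρ hρ u p H c P hP hu _hsw hH hc
  have hE : ∀ a : ℝ, 0 < a →
      ENNReal.ofReal (a ^ ρ) * cknE a (0 : ℝ × EuclideanSpace ℝ (Fin 3)) H ≤ (c : ℝ≥0∞) :=
    fun a ha => le_trans (le_trans le_add_self le_self_add) (hc a ha)
  have hA : ∀ a : ℝ, 0 < a → ENNReal.ofReal (a ^ (2 * ρ)) *
      cknA a (0 : ℝ × EuclideanSpace ℝ (Fin 3)) u ≤ (c : ℝ≥0∞) :=
    fun a ha => le_trans (le_trans le_self_add le_self_add) (hc a ha)
  -- `H = 0` a.e. on the slab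
  have hH0 : ∀ᵐ z ∂(volume.restrict (Iio (0 : ℝ) ×ˢ (univ : Set (EuclideanSpace ℝ (Fin 3))))),
      H z.1 z.2 = 0 := weakGradient_ae_zero_of_periodic hH hP hu hρ hE
  -- a.e. slice is a.e. constant, and the constant is `0`
  have hslice := PowerGaugeSteady.ae_slice_const_of_weakGradient_ae_zero isOpen_Iio hH hH0
  have hzero : ∀ᵐ τ ∂(volume.restrict (Iio (0 : ℝ))), u τ =ᵐ[volume] 0 := by
    filter_upwards [hslice, ae_restrict_mem measurableSet_Iio] with τ hτ hτ0
    obtain ⟨b, hb⟩ := hτ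
    have hb0 : b = 0 := slice_const_eq_zero_of_gaugeA hρ hτ0 hb hA
    rw [hb0] at hb
    exact hb
  -- slices ⇒ slab
  have hmeas : AEStronglyMeasurable (uncurry u)
      (volume.restrict (Iio (0 : ℝ) ×ˢ (univ : Set (EuclideanSpace ℝ (Fin 3))))) := by
    have := hH.locallyIntegrableOn.aestronglyMeasurable
    simpa [slab] using this
  have h := ae_eq_zero_slab_of_ae_slice hmeas hzero
  filter_upwards [h] with z hz
  exact hz

/-- **The time-periodic stratum is a literal sub-case of the crux**
`E = EulerZoomLiouville.PowerGaugeEulerLiouville` (stmt-NavierStokesRegularity-19832): adding the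
periodicity hypothesis to the route decl gives exactly the statement of
`powerGaugeEulerLiouville_timePeriodic` (so the stratum sits strictly inside `E`). [folklore] -/
theorem timePeriodic_of_powerGaugeEulerLiouville
    (hE : Summit.NavierStokesRegularity.NavierStokesRegularity.Theses.EulerZoomLiouville.PowerGaugeEulerLiouville) :
    ∀ ρ : ℝ, 0 < ρ → ∀ (u : ℝ → EuclideanSpace ℝ (Fin 3) → EuclideanSpace ℝ (Fin 3))
      (p : ℝ → EuclideanSpace ℝ (Fin 3) → ℝ)
      (H : ℝ → EuclideanSpace ℝ (Fin 3) → EuclideanSpace ℝ (Fin 3) →L[ℝ] EuclideanSpace ℝ (Fin 3))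
      (c : NNReal) (P : ℝ), 0 < P → (∀ τ : ℝ, τ < 0 → u (τ - P) = u τ) →
      Literature.Analysis.FluidPDE.IsSuitableWeakSolutionOn
          (Literature.Analysis.FluidPDE.slab (EuclideanSpace ℝ (Fin 3)) (Set.Iio 0) isOpen_Iio) 0 0 u p →
      Literature.Analysis.FluidPDE.HasWeakSpatialGradientOn
          (Literature.Analysis.FluidPDE.slab (EuclideanSpace ℝ (Fin 3)) (Set.Iio 0) isOpen_Iio) u H →
      (∀ a : ℝ, 0 < a →
        ENNReal.ofReal (a ^ (2 * ρ)) *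
            Literature.Analysis.FluidPDE.cknA a (0 : ℝ × EuclideanSpace ℝ (Fin 3)) u +
          ENNReal.ofReal (a ^ ρ) *
            Literature.Analysis.FluidPDE.cknE a (0 : ℝ × EuclideanSpace ℝ (Fin 3)) H +
          ENNReal.ofReal (a ^ (2 * ρ)) *
            Literature.Analysis.FluidPDE.cknD a (0 : ℝ × EuclideanSpace ℝ (Fin 3)) p ≤
          (c : ENNReal)) →
      Function.uncurry u =ᵐ[volume.restrict
        (Set.Iio (0 : ℝ) ×ˢ (Set.univ : Set (EuclideanSpace ℝ (Fin 3))))] 0 :=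
  fun ρ hρ u p H c _P _hP _hu hsw hH hc => hE ρ hρ u p H c hsw hH hc


end Summit.NavierStokesRegularity.NavierStokesRegularity.Theorems.PowerGaugeEulerLiouville.TimePeriodic

end
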